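import Summits.BirchSwinnertonDyer.Rank1Residual.F1Sign2.SharpLambdaFairCoinAtTwo
import HarnessLib

/-!
# Cell `bsd-f1-sign2` — kernel proof of P52s `FESolutionModTwoDeterminedByOddCoeffsAtTwo` (IMC-Λ♯52, `F1Sign2/SharpLambdaFairCoinAtTwo.lean`)

THEOREMS ONLY (no `def`, no `sorry`, no named fact), typer -ty g16.  REF1-AUDIT §178 graded P52s «THEOREM-grade TRUE; typed faithfully … cheapest
kernel target of the packet (PowerSeries.subst API); proof owed», with the paper proof (5 lines): «mod `2`, if all odd coefficients of `h` vanish then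
`h(T) = g(T²)` and Frobenius gives `h(S/(1+S)) = g(S²/(1+S²))`, even in the same sense, so `(1+S)^x h(S)` has zero odd part; with `x` odd, comparing the
coefficient of `T^{2a+1}` where `T^{2a}` is the lowest term of `h` gives `x·h_{2a} ≡ h_{2a} = 0` — contradiction unless `h = 0`.»  This file formalises
exactly that argument, reduced modulo `2` along any ring map `φ : ℤ₂ → 𝔽₂` with `ker φ = (2)` (instantiated with `PadicInt.toZMod`):
* `coeff_odd_mul_eq_zero`, `coeff_odd_pow_eq_zero` — power series with vanishing odd-degree coefficients are closed under products and powers;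
* `coeff_odd_mul_self_eq_zero` — over `ZMod 2` a square `F·F` has no odd-degree coefficients (the cross terms pair off: `Finset.sum_involution`);
* `coeff_odd_subst_eq_zero` — hence substituting `u` with `u²` even-supported into an even-supported series stays even-supported (`PowerSeries.coeff_subst'`);
* `feSolution_parity_aux` — the mod-2 argument for an abstract `φ`; `feSolutionModTwoDeterminedByOddCoeffsAtTwo_holds : FESolutionModTwoDeterminedByOddCoeffsAtTwo`.
[cite: Sprung2017, Cor. 4.14 (the functional equation whose parity consequence this is)]  BSD is not proved by this; no item closed (P52s is a plain-`def` support row).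
-/

noncomputable section

open scoped Classical

open PowerSeries Literature.Barriers.BirchSwinnertonDyer

namespace Summit.BirchSwinnertonDyer.Rank1Residual.F1Sign2

/-! ### Even-supported power series -/

/-- Products of power series with vanishing odd-degree coefficients have vanishing odd-degree coefficients. -/
theorem coeff_odd_mul_eq_zero {R : Type*} [CommSemiring R] {F G : R⟦X⟧}
    (hF : ∀ a, coeff (2 * a + 1) F = 0) (hG : ∀ a, coeff (2 * a + 1) G = 0) (a : ℕ) :
    coeff (2 * a + 1) (F * G) = 0 := by
  rw [coeff_mul]
  refine Finset.sum_eq_zero ?_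
  rintro ⟨i, j⟩ hij
  rw [Finset.mem_antidiagonal] at hij
  rcases Nat.even_or_odd i with ⟨k, hk⟩ | ⟨k, hk⟩
  · have hj : j = 2 * (a - k) + 1 := by omega
    simp only [hj, hG, mul_zero]
  · have hi : i = 2 * k + 1 := by omega
    simp only [hi, hF, zero_mul]

/-- … hence so do their powers. -/
theorem coeff_odd_pow_eq_zero {R : Type*} [CommSemiring R] {F : R⟦X⟧}
    (hF : ∀ a, coeff (2 * a + 1) F = 0) (n a : ℕ) : coeff (2 * a + 1) (F ^ n) = 0 := by
  induction n generalizing a with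
  | zero =>
    rw [pow_zero, coeff_one]
    simp
  | succ n ih =>
    rw [pow_succ]
    exact coeff_odd_mul_eq_zero ih hF a

/-- Over `ZMod 2` (characteristic `2`) a square has no odd-degree coefficients: in `∑_{i+j = 2a+1} F_i F_j` the terms `(i,j)` and
`(j,i)` are distinct and cancel. -/
theorem coeff_odd_mul_self_eq_zero (F : (ZMod 2)⟦X⟧) (a : ℕ) : coeff (2 * a + 1) (F * F) = 0 := by
  rw [coeff_mul]
  refine Finset.sum_involution (fun ij _ => ij.swap) ?_ ?_ ?_ ?_
  · rintro ⟨i, j⟩ _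
    simp only [Prod.swap_prod_mk]
    rw [mul_comm (coeff j F) (coeff i F), ← two_mul, show (2 : ZMod 2) = 0 from rfl, zero_mul]
  · rintro ⟨i, j⟩ hij _
    rw [Finset.mem_antidiagonal] at hij
    simp only [Prod.swap_prod_mk, ne_eq, Prod.mk.injEq]
    omega
  · rintro ⟨i, j⟩ hij
    rw [Finset.mem_antidiagonal] at hij ⊢
    simp only [Prod.swap_prod_mk]
    omega
  · rintro ⟨i, j⟩ _
    rfl

/-- Substituting a series `u` whose square is even-supported into an even-supported series gives an even-supported series
(`D(u) = ∑ d_{2k} (u²)^k`). -/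
theorem coeff_odd_subst_eq_zero {R : Type*} [CommRing R] {D u : R⟦X⟧} (hu : HasSubst u)
    (hD : ∀ a, coeff (2 * a + 1) D = 0) (hu2 : ∀ a, coeff (2 * a + 1) (u * u) = 0) (a : ℕ) :
    coeff (2 * a + 1) (D.subst u) = 0 := by
  rw [coeff_subst' hu]
  refine finsum_eq_zero_of_forall_eq_zero fun d => ?_
  rcases Nat.even_or_odd d with ⟨k, hk⟩ | ⟨k, hk⟩
  · have hpow : u ^ d = (u * u) ^ k := by
      rw [hk, ← two_mul, pow_mul, sq]
    rw [hpow, coeff_odd_pow_eq_zero hu2 k a, smul_zero]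
  · have hd : d = 2 * k + 1 := by omega
    rw [hd, hD, zero_smul]

/-! ### The mod-2 argument -/

/-- REF1 §178's five-line proof, for an abstract reduction map `φ : ℤ₂ → 𝔽₂` with kernel `(2)`. -/
theorem feSolution_parity_aux (φ : ℤ_[2] →+* ZMod 2) (hφ : ∀ c : ℤ_[2], (2 : ℤ_[2]) ∣ c ↔ φ c = 0)
    (σ : ℤ) (x : ℤ_[2]) (D : PowerSeries ℤ_[2]) (hσ : σ ^ 2 = 1) (hx : ¬ (2 : ℤ_[2]) ∣ x)
    (hFE : D.subst (invOnePlusSubOne : PowerSeries ℤ_[2]) =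
      (σ : PowerSeries ℤ_[2]) * PowerSeries.binomialSeries ℤ_[2] x * D)
    (hodd : ∀ j : ℕ, (2 : ℤ_[2]) ∣ coeff (2 * j + 1) D) (i : ℕ) : (2 : ℤ_[2]) ∣ coeff i D := by
  -- odd coefficients of the reduction vanish
  have hDodd : ∀ a, coeff (2 * a + 1) (PowerSeries.map φ D) = 0 := fun a => by
    rw [coeff_map]
    exact (hφ _).mp (hodd a)
  -- it suffices that the reduction vanishes
  suffices hzero : ∀ n, coeff n (PowerSeries.map φ D) = 0 by
    have h := hzero i
    rw [coeff_map] at h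
    exact (hφ _).mpr h
  by_contra hne
  push Not at hne
  obtain ⟨m, hm, hmin⟩ : ∃ m, coeff m (PowerSeries.map φ D) ≠ 0 ∧ ∀ j < m, coeff j (PowerSeries.map φ D) = 0 :=
    ⟨Nat.find hne, Nat.find_spec hne, fun j hj => not_not.mp (Nat.find_min hne hj)⟩
  -- the order `m` is even
  obtain ⟨a, ha⟩ : ∃ a, m = 2 * a := by
    rcases Nat.even_or_odd m with ⟨k, hk⟩ | ⟨k, hk⟩
    · exact ⟨k, by omega⟩
    · exact absurd (by rw [show m = 2 * k + 1 by omega]; exact hDodd k) hm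
  -- reduce the substituted series and the functional equation modulo 2
  have hι : PowerSeries.map φ (invOnePlusSubOne : PowerSeries ℤ_[2]) = (invOnePlusSubOne : PowerSeries (ZMod 2)) := by
    ext n
    simp only [invOnePlusSubOne, coeff_map, coeff_mk]
    split_ifs <;> simp
  have hu : HasSubst (invOnePlusSubOne : PowerSeries (ZMod 2)) := hasSubst_invOnePlusSubOne
  have hFE' : (PowerSeries.map φ D).subst (invOnePlusSubOne : PowerSeries (ZMod 2)) =
      PowerSeries.map φ (σ : PowerSeries ℤ_[2]) * PowerSeries.map φ (PowerSeries.binomialSeries ℤ_[2] x) *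
        PowerSeries.map φ D := by
    have h := congrArg (PowerSeries.map φ) hFE
    have hms : PowerSeries.map φ (D.subst (invOnePlusSubOne : PowerSeries ℤ_[2])) =
        (PowerSeries.map φ D).subst (PowerSeries.map φ (invOnePlusSubOne : PowerSeries ℤ_[2])) :=
      map_subst hasSubst_invOnePlusSubOne D
    rw [hms, hι, map_mul, map_mul] at h
    exact h
  -- the odd coefficient `m + 1` of the left side vanishes …
  have hL : coeff (m + 1) ((PowerSeries.map φ D).subst (invOnePlusSubOne : PowerSeries (ZMod 2))) = 0 := by
    rw [ha]
    exact coeff_odd_subst_eq_zero hu hDodd (coeff_odd_mul_self_eq_zero _) a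
  -- … while the coefficient `m + 1` of `(1+X)^x · D̄` is `x̄ · d_m ≠ 0`
  have hB : coeff (m + 1) (PowerSeries.map φ (PowerSeries.binomialSeries ℤ_[2] x) * PowerSeries.map φ D) =
      φ x * coeff m (PowerSeries.map φ D) := by
    rw [coeff_mul, Finset.sum_eq_single (1, m)]
    · rw [coeff_map, binomialSeries_coeff, Ring.choose_one_right, smul_eq_mul, mul_one]
    · rintro ⟨k, j⟩ hkj hne'
      rw [Finset.mem_antidiagonal] at hkj
      rcases lt_trichotomy j m with hj | hj | hj
      · rw [hmin j hj, mul_zero]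
      · exfalso
        apply hne'
        simp only [Prod.mk.injEq]
        omega
      · have hj' : j = 2 * a + 1 := by omega
        rw [hj', hDodd a, mul_zero]
    · intro h
      exact absurd (Finset.mem_antidiagonal.mpr (by omega)) h
  have hxne : φ x ≠ 0 := fun h0 => hx ((hφ x).mpr h0)
  have hBne : coeff (m + 1) (PowerSeries.map φ (PowerSeries.binomialSeries ℤ_[2] x) * PowerSeries.map φ D) ≠ 0 := by
    rw [hB]
    exact mul_ne_zero hxne hm
  have hR : coeff (m + 1) (PowerSeries.map φ (σ : PowerSeries ℤ_[2]) *
      PowerSeries.map φ (PowerSeries.binomialSeries ℤ_[2] x) * PowerSeries.map φ D) ≠ 0 := by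
    rcases sq_eq_one_iff.mp hσ with h | h
    · rw [h, Int.cast_one, map_one, one_mul]
      exact hBne
    · rw [h, Int.cast_neg, Int.cast_one, map_neg, map_one, neg_one_mul, neg_mul, map_neg, neg_ne_zero]
      exact hBne
  rw [← hFE'] at hR
  exact hR hL

/-- **P52s holds**: a solution `D ∈ ℤ₂⟦T⟧` of Sprung's functional equation `D(S/(1+S)·(−1)) = σ (1+T)^x D` with `σ = ±1` and `x` odd whose odd-degree
coefficients are all even has all coefficients even (REF1-AUDIT §178: THEOREM-grade; proved here by reduction modulo `2` via `PadicInt.toZMod`). -/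
theorem feSolutionModTwoDeterminedByOddCoeffsAtTwo_holds : FESolutionModTwoDeterminedByOddCoeffsAtTwo := by
  intro σ x D hσ hx hFE hodd i
  refine feSolution_parity_aux (PadicInt.toZMod : ℤ_[2] →+* ZMod 2) (fun c => ?_) σ x D hσ hx hFE hodd i
  rw [← RingHom.mem_ker, PadicInt.ker_toZMod, PadicInt.maximalIdeal_eq_span_p, Ideal.mem_span_singleton]
  norm_num

end Summit.BirchSwinnertonDyer.Rank1Residual.F1Sign2

end
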